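import Summits.BirchSwinnertonDyer.BirchSwinnertonDyer.Theses.PrintX10b
import Literature.NumberTheory.Automorphic.CongruenceSubgroupPropertySL2AwayHolds
import HarnessLib

set_option linter.dupNamespace false

/-!
# Route `PrintX10b`, aside `SerreCongruenceSubgroupPropertyAway` (stmt-BirchSwinnertonDyer-23011) — CLOSED by name

The route item `PrintX10b.SerreCongruenceSubgroupPropertyAway` is, by definition, the named statement
(C) `Literature.NumberTheory.Automorphic.SerreSL2Congruence1970_congruenceSubgroupProperty_away`
(Serre 1970, §2.6 Théorème 2 (b) / Cor. 3 at `K = ℚ`: every finite-index subgroup of `SL₂(ℤ[1/m])`,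
`m ≥ 2`, contains a principal congruence subgroup `Γ(𝔮)`, `𝔮 ≠ ⊥`).  That statement is now a THEOREM of
the tree: `SerreSL2Congruence1970_congruenceSubgroupProperty_away_holds`
(`Literature/NumberTheory/Automorphic/CongruenceSubgroupPropertySL2AwayHolds.lean`, cell bsd-print-x8 ty2;
road: the Moore-free reduction `congruenceSubgroupProperty_away_of_relG_le_relE` + Vaserstein's
`SL2Rel.Away.relG_le_relE_span_natCast` over `Localization.Away`, via Liehl's lemmas and the triviality of
Mennicke symbols on `W_q(ℤ[1/m])`, Bass–Milnor–Serre Thm. 3.6).  This file only records the closure of the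
route item BY NAME; it adds no mathematics and no named fact.  The same item is conjunct (C) of the
support bundle `PrintX10b.TheoremBInputsX10b` (stmt-22501) and is also wanted by route `PrintX8VS`.
[cite: SerreSL2Congruence1970, §2.6 Thm. 2 (b), Cor. 3]
-/

namespace Summit.BirchSwinnertonDyer.BirchSwinnertonDyer.Theorems.PrintX10bSerreCongruenceSubgroupPropertyAway

open Summit.BirchSwinnertonDyer.BirchSwinnertonDyer.Theses.PrintX10b (SerreCongruenceSubgroupPropertyAway)

/-- **The aside `SerreCongruenceSubgroupPropertyAway` of route `PrintX10b` holds** (item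
stmt-BirchSwinnertonDyer-23011): the congruence subgroup property of `SL₂(ℤ[1/m])`, `m ≥ 2`, in the
tree's typed form (C), by the tree theorem
`Literature.NumberTheory.Automorphic.SerreSL2Congruence1970_congruenceSubgroupProperty_away_holds`.
[cite: SerreSL2Congruence1970, §2.6 Thm. 2 (b), Cor. 3] -/
theorem serreCongruenceSubgroupPropertyAway_holds : SerreCongruenceSubgroupPropertyAway :=
  Literature.NumberTheory.Automorphic.SerreSL2Congruence1970_congruenceSubgroupProperty_away_holds

end Summit.BirchSwinnertonDyer.BirchSwinnertonDyer.Theorems.PrintX10bSerreCongruenceSubgroupPropertyAway
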